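import Summits.QuantumFields.YangMills.Theorems.BalabanUVNodesN12GaugeLetterLocOfClass
import HarnessLib

/-!
# BalabanUVNodes ∕ N12 — THE DATUM LETTER OF THE (σ)_N CAPSTONE IS GEOMETRY: at the data `M˙(Q_k^{s*}W)` the level-`i` entry at a member bond `c` is `1` or the SHADOW value
# `W⟨B^k(ι_i c₋), μ(c)⟩` ([III] p. 267, [15] p. 193), so `dist1 ≤ ρn` as soon as the `k`-shadows of the face-crossing members lie in the bond set `𝒞` where `W` is `ρn`-near `1` — the
# capstone of `N12GaugeLetterLocOfClass` with the datum letter `hWj` replaced by that shadow geometry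

Cell `pub-ymgap` (HUMAN RULINGS D-0062 ∕ D-0149), WIDTH SEAT `pub-ymgap-dag-n12-w3` g4 (node N12 = [B15]; key K1⁹ `stmt-QuantumFields-27364` (KEY MAP v2), `--kind proof --supports … --as
helper`; count-neutral).  THEOREMS ONLY (0 `def`, 0 `instance`, 0 `sorry`); consumed BY NAME: `B15Prop1MinimiserTowerAxialGauge.dist1_avgFamily_avOfRecord_qsstarGIter0_le` (p622221 §5, the datum side
per level), `B15Prop1DatumSmall7AtZSequence.blockIter_add_embIter` (`B^{i+n}(ι_i y) = B^n(y)`, the index bridge), this lineage's `N12GaugeLetterLocOfClass.exists_gaugeLetterLoc_atRecord_of_class`.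

WHY.  The capstones display the DATUM letter `hWj : ∀ i ≤ k, ∀ c ∈ bondsOf 𝐁_k(Z)_i, dist1 ((M˙(Q_k^{s*}W))_i c) ≤ δ₁`.  By [III] p. 267 («M^{k+1}(U_{k+1}) = V_{k+1} … by the constraints») and the
structure of `Q^{s*}` ([15] p. 193) the level-`i` entry of `M˙(Q_k^{s*}W)` at `c` is `1` when `c` lies inside a `(k−i)`-block and the value of `W` at the `k`-bond `⟨B^{k−i}c₋, μ(c)⟩` when `c`
crosses a `(k−i)`-block face (`B15Prop1MinimiserTowerAxialGauge` §5).  THIS FILE: ★★ `datumLetter_of_shadows` — `hWj` with `δ₁ := ρn` from `dist1 (W c′) ≤ ρn` on `𝒞` and the GEOMETRY letter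
«the `k`-shadow `⟨B^k(ι_i c₋), μ(c)⟩` of every face-crossing member lies in `𝒞`» (fine-point form, no dependent level arithmetic; the index bridge `blockIter_add_embIter` inside); ★★★
`exists_gaugeLetterLoc_atRecord_of_class_of_shadows` — the class capstone with `hWj` so replaced: RESIDUE = minimiser in NODE 00's class, `W 𝒞 ρn`, the `N`-geometry `hGN`∕`hN1`, the shadow
geometry `hGmem` (dag-n12-w6's `hGN` is its level-`0` instance over `N`), the plaquette letter `a_j`∕`θ` on the iterated averages, no-wrap, the radius numerics.

HONEST FRAMING.  Composition by name; the minimiser ([15] Thm 1 ∕ (E)), the region datum, the geometry letters, the iterated-average plaquette letter ([Balaban1985Averaging] Prop. 1–2, local) and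
the numerics stay HYPOTHESES; nothing of Bałaban's asserted; count-neutral; N12 NOT discharged; K1⁹ NOT closed; counts unmoved (typed 28∕28 · discharged 5∕27); one finite 𝕋⁴ programme at fixed ε —
R4 closes the conditional rung `BalabanLadder.UV` only; the Yang–Mills mass gap (Clay) is NOT proved by any of this; nothing continuum ∕ ℝ⁴ ∕ OS.
-/

noncomputable section

open scoped Matrix.Norms.L2Operator BigOperators

namespace Summit.QuantumFields.YangMills.BalabanUVNodes.N12DatumLetterOfShadows

open Literature.MathematicalPhysics.QuantumFieldTheory.Balaban1983to89
open T4Continuum GaugeField B15DeterminingSets BlockAveraging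
open T4CubeChartGnomonic (SU2)
open B16Sect1Backgrounds (toMS)
open T4AxialGaugeSmallField (boxPlaqs)
open B14.Eq213MaximalDomains (side)
open B14.Eq213DetSet (Bj maxDomT)
open B14.Eq216Concrete (inputs)
open B14.Eq22Determines (blockIter)
open B5Eq118OneStroke (iterBlockOf)
open B8Eq17ClassAkV1 (plaqsOf)
open ExpMeanLog (deltaSU)
open Literature.MathematicalPhysics.QuantumFieldTheory.BalabanImbrieJaffe1984to88.BIJ85Eq453GaugeField (qsstarGIter0)
open B15Prop1MinimiserTowerAxialGauge (dist1_avgFamily_avOfRecord_qsstarGIter0_le)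
open B15Prop1DatumSmall7AtZSequence (blockIter_add_embIter)
open Summit.QuantumFields.YangMills.BalabanUVNodes.N12GaugeLetterLocOfClass (exists_gaugeLetterLoc_atRecord_of_class)

variable {P : Params}

/-! ## §1 The datum letter from the shadow geometry -/

/-- ★★ **THE DATUM LETTER FROM THE SHADOWS.**  Torus `F.P Kt`, group `SU(N)`, averaging of record, `k ≤ m + K`, any determining set `𝔹`, a `k`-field `W` that is `ρn`-near `1` on a bond set `𝒞`
(`0 ≤ ρn`).  If the `k`-SHADOW `⟨B^k(ι_i c₋), μ(c)⟩` of every member bond `c` of `𝔹_i` (`i ≤ k`) whose ends have different `k`-blocks lies in `𝒞`, then the level-`i` entry of the data `M˙(Q_k^{s*}W)`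
at every member bond is `ρn`-near `1` — the letter `hWj` of the (σ)_N capstones with `δ₁ := ρn`.  (p622221 §5 per level; the index bridge `B^{i+n}(ι_i y) = B^n(y)`.)
[cite: Balaban1988Convergent, (2.16) p.257, p.267 L5–7; Balaban1989LargeFieldI, p.193 L14–16; Balaban1987RG1, (0.1) p.251, (0.4) p.253] -/
theorem datumLetter_of_shadows {F : T4Family} {N : ℕ} [NeZero N] (Kt : ℕ) {k : ℕ} (hk : k ≤ (F.P Kt).m + (F.P Kt).K) (𝔹 : DetSet (F.P Kt))
    (W : GaugeField (F.P Kt) k (Node00.SU N)) {𝒞 : Set (PBond (F.P Kt) k)} {ρn : ℝ} (hρn : 0 ≤ ρn) (hD : ∀ c ∈ 𝒞, dist1 (W c) ≤ ρn)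
    (hGmem : ∀ i ≤ k, ∀ c ∈ bondsOf (𝔹 i), blockIter k (embIter i c.tgt) ≠ blockIter k (embIter i c.src) →
      (⟨blockIter k (embIter i c.src), c.dir⟩ : PBond (F.P Kt) k) ∈ 𝒞) :
    ∀ i ≤ k, ∀ c ∈ bondsOf (𝔹 i), dist1 (avgFamily (Node00.avOfRecord F N Kt) (qsstarGIter0 k W) i c) ≤ ρn := by
  intro i hi c hc
  obtain ⟨n, rfl⟩ := Nat.exists_eq_add_of_le hi
  have hG := hGmem i hi c hc
  rw [blockIter_add_embIter i n hk c.tgt, blockIter_add_embIter i n hk c.src] at hG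
  exact dist1_avgFamily_avOfRecord_qsstarGIter0_le Kt hk W hρn c fun hne => hD _ (hG hne)

/-! ## §2 The class capstone with the datum letter replaced by the shadow geometry -/

/-- ★★★ **(σ)_N AT THE RECORD FROM THE CLASS AND THE SHADOW GEOMETRY.**  As `N12GaugeLetterLocOfClass.exists_gaugeLetterLoc_atRecord_of_class`, with the datum letter `hWj` replaced by the
geometry letter «the `k`-shadows of the face-crossing members of `𝐁_k(Z)` lie in `𝒞`» (`δ₁ := ρn`).  RESIDUE: the minimiser in NODE 00's class, the region datum `W 𝒞 ρn`, the `N`-geometry, the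
shadow geometry, the plaquette letter `a_j`∕`θ` on the iterated averages near member segments, no wrapping, the radius numerics, `0 ≤ εreg`, `2 ≤ M₁`, cover divisibility.
[cite: Balaban1985Variational, (2)–(4) p.278, (16)–(18) p.280; Balaban1985RegularSpaces, (1.7) p.77, (1.19) p.79; Balaban1988Convergent, (2.12)–(2.13) pp.256–257, (2.16) p.257, p.267; Balaban1987RG1, (0.4) p.253] -/
theorem exists_gaugeLetterLoc_atRecord_of_class_of_shadows {F : T4Family} (ν : Node00.Stage7Numerics) (Kt : ℕ) {k : ℕ} (hk0 : 0 < k) (hk : k ≤ (F.P Kt).m + (F.P Kt).K)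
    (hM2 : 2 ≤ ν.M₁) (hdiv : side (F.P Kt).L ν.M₁ k ∣ (F.P Kt).sitesPerDir 0) (Z : Set (Site (F.P Kt) 0)) (hεreg : 0 ≤ ν.εreg)
    -- no wrapping, at the caps `ℓ_k`, `m·L^k`
    (hN : 2 * (∑ i ∈ Finset.range (k + 1), ((F.P Kt).d * (((F.P Kt).L ^ i - 1) / 2) + 1)) + 1 +
      (3 * ((F.P Kt).d * (((F.P Kt).L - 1) / 2)) + 5) * (F.P Kt).L ^ k < (F.P Kt).sitesPerDir 0)
    -- radius numerics: the level-`J` box fits the collar `L^{J−1}·M₁`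
    (hRad : ∀ J, 1 ≤ J → J ≤ k →
      (2 * ∑ i ∈ Finset.range (J + 1 + 1), ((F.P Kt).d * (((F.P Kt).L ^ i - 1) / 2) + 1)) + 1 +
          (3 * ((F.P Kt).d * (((F.P Kt).L - 1) / 2)) + 5) * (F.P Kt).L ^ min (J + 1) k +
        (∑ i ∈ Finset.range (J + 1), ((F.P Kt).d * (((F.P Kt).L ^ i - 1) / 2) + 1)) + 3 ≤ (F.P Kt).L ^ (J - 1) * ν.M₁)
    -- the region-normalised datum and the minimiser
    {ρn : ℝ} (hρn : 0 ≤ ρn)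
    (W : GaugeField (F.P Kt) k SU2) (𝒞 : Set (PBond (F.P Kt) k)) (hD : ∀ c ∈ 𝒞, dist1 (W c) ≤ ρn)
    {U₀ : GaugeField (F.P Kt) 0 SU2}
    (hmin : IsMinimizer (Node00.avOfRecord F 2 Kt) (Node00.regMSCoPOfRecord F 2 ν Kt k (maxDomT ν.M₁ Z)) (Bj ν.M₁ Z k)
      (avgFamily (Node00.avOfRecord F 2 Kt) (qsstarGIter0 k W)) U₀)
    -- geometry of the neighbourhood (dag-n12-w6's letters, verbatim)
    (N : Set (PBond (F.P Kt) 0))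
    (hGN : ∀ b ∈ N, (b.src ∉ maxDomT ν.M₁ Z 1 ∨ b.tgt ∉ maxDomT ν.M₁ Z 1) → blockIter k b.tgt ≠ blockIter k b.src →
      (⟨blockIter k b.src, b.dir⟩ : PBond (F.P Kt) k) ∈ 𝒞)
    (hN1 : ∀ p : Plaq (F.P Kt) 0, ((⟨p.src, p.μ⟩ : PBond (F.P Kt) 0) ∈ {b : PBond (F.P Kt) 0 | b.src ∈ maxDomT ν.M₁ Z 1} ∨
        (⟨p.src.shift p.μ, p.ν⟩ : PBond (F.P Kt) 0) ∈ {b : PBond (F.P Kt) 0 | b.src ∈ maxDomT ν.M₁ Z 1} ∨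
        (⟨p.src.shift p.ν, p.μ⟩ : PBond (F.P Kt) 0) ∈ {b : PBond (F.P Kt) 0 | b.src ∈ maxDomT ν.M₁ Z 1} ∨
        (⟨p.src, p.ν⟩ : PBond (F.P Kt) 0) ∈ {b : PBond (F.P Kt) 0 | b.src ∈ maxDomT ν.M₁ Z 1}) →
      (⟨p.src, p.μ⟩ : PBond (F.P Kt) 0) ∈ N ∧ (⟨p.src.shift p.μ, p.ν⟩ : PBond (F.P Kt) 0) ∈ N ∧
        (⟨p.src.shift p.ν, p.μ⟩ : PBond (F.P Kt) 0) ∈ N ∧ (⟨p.src, p.ν⟩ : PBond (F.P Kt) 0) ∈ N)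
    -- DISPLAYED: the plaquette letter on the iterated averages near the member segments, with its budgets
    (a θ : ℕ → ℝ) (hθ0 : 0 ≤ θ 0) (ha0 : ∀ j, 0 ≤ a j)
    (haN : ∀ j < k, (((((F.P Kt).d + 2) * (F.P Kt).L : ℕ) : ℝ) ^ 2 / 4) * a j < deltaSU (Fin 2))
    (hθ : ∀ j, 6 * ((((((F.P Kt).d + 2) * (F.P Kt).L : ℕ) : ℝ) ^ 2 / 4) * a j) + (F.P Kt).L * θ j ≤ θ (j + 1))
    (ha : ∀ i ≤ k, ∀ c ∈ bondsOf ((Bj ν.M₁ Z k : DetSet (F.P Kt)) i), ∀ j < i, ∀ c' : PBond (F.P Kt) (j + 1), c'.dir = c.dir →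
      (∃ s < (F.P Kt).L ^ i, embIter (j + 1) c'.src = (fun z : Site (F.P Kt) 0 => z.shift c.dir)^[s] (embIter i c.src)) →
      ∀ q : Plaq (F.P Kt) j, (blockOf q.src = c'.src.unshift c'.dir ∨ blockOf q.src = c'.src ∨ blockOf q.src = c'.tgt) →
        dist1 (GaugeField.plaqHol (avgFamily (Node00.avOfRecord F 2 Kt) U₀ j) q) < a j)
    -- GEOMETRY instead of the datum letter: the `k`-shadows of the face-crossing members of `𝐁_k(Z)` lie in `𝒞`
    (hGmem : ∀ i ≤ k, ∀ c ∈ bondsOf ((Bj ν.M₁ Z k : DetSet (F.P Kt)) i), blockIter k (embIter i c.tgt) ≠ blockIter k (embIter i c.src) →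
      (⟨blockIter k (embIter i c.src), c.dir⟩ : PBond (F.P Kt) k) ∈ 𝒞) :
    ∃ σ : GaugeTransf (F.P Kt) 0 SU2,
      (∀ j, j ≤ k → ∀ b ∈ bondsOf (Bj ν.M₁ Z k j), toMS σ j b.src = 1 ∧ toMS σ j b.tgt = 1) ∧
        (∀ p : Plaq (F.P Kt) 0, ((⟨p.src, p.μ⟩ : PBond (F.P Kt) 0) ∈ {b : PBond (F.P Kt) 0 | b.src ∈ maxDomT ν.M₁ Z 1} ∨
            (⟨p.src.shift p.μ, p.ν⟩ : PBond (F.P Kt) 0) ∈ {b : PBond (F.P Kt) 0 | b.src ∈ maxDomT ν.M₁ Z 1} ∨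
            (⟨p.src.shift p.ν, p.μ⟩ : PBond (F.P Kt) 0) ∈ {b : PBond (F.P Kt) 0 | b.src ∈ maxDomT ν.M₁ Z 1} ∨
            (⟨p.src, p.ν⟩ : PBond (F.P Kt) 0) ∈ {b : PBond (F.P Kt) 0 | b.src ∈ maxDomT ν.M₁ Z 1}) →
          ‖((gaugeAct σ U₀ ⟨p.src, p.μ⟩ : SU2) : Matrix (Fin 2) (Fin 2) ℂ) - 1‖ ≤
              max ρn ((((2 * (∑ i ∈ Finset.range (k + 1), ((F.P Kt).d * (((F.P Kt).L ^ i - 1) / 2) + 1)) + 1 +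
                  (3 * ((F.P Kt).d * (((F.P Kt).L - 1) / 2)) + 5) * (F.P Kt).L ^ k : ℕ) : ℝ)) ^ 2 / 4 * (ν.εreg * (F.P Kt).eta 0 ^ 2) +
                ((3 * ((F.P Kt).d * (((F.P Kt).L - 1) / 2)) + 5 : ℕ) : ℝ) * θ k + ((3 * ((F.P Kt).d * (((F.P Kt).L - 1) / 2)) + 5 : ℕ) : ℝ) * ρn) ∧
            ‖((gaugeAct σ U₀ ⟨p.src.shift p.μ, p.ν⟩ : SU2) : Matrix (Fin 2) (Fin 2) ℂ) - 1‖ ≤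
              max ρn ((((2 * (∑ i ∈ Finset.range (k + 1), ((F.P Kt).d * (((F.P Kt).L ^ i - 1) / 2) + 1)) + 1 +
                  (3 * ((F.P Kt).d * (((F.P Kt).L - 1) / 2)) + 5) * (F.P Kt).L ^ k : ℕ) : ℝ)) ^ 2 / 4 * (ν.εreg * (F.P Kt).eta 0 ^ 2) +
                ((3 * ((F.P Kt).d * (((F.P Kt).L - 1) / 2)) + 5 : ℕ) : ℝ) * θ k + ((3 * ((F.P Kt).d * (((F.P Kt).L - 1) / 2)) + 5 : ℕ) : ℝ) * ρn) ∧
            ‖((gaugeAct σ U₀ ⟨p.src.shift p.ν, p.μ⟩ : SU2) : Matrix (Fin 2) (Fin 2) ℂ) - 1‖ ≤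
              max ρn ((((2 * (∑ i ∈ Finset.range (k + 1), ((F.P Kt).d * (((F.P Kt).L ^ i - 1) / 2) + 1)) + 1 +
                  (3 * ((F.P Kt).d * (((F.P Kt).L - 1) / 2)) + 5) * (F.P Kt).L ^ k : ℕ) : ℝ)) ^ 2 / 4 * (ν.εreg * (F.P Kt).eta 0 ^ 2) +
                ((3 * ((F.P Kt).d * (((F.P Kt).L - 1) / 2)) + 5 : ℕ) : ℝ) * θ k + ((3 * ((F.P Kt).d * (((F.P Kt).L - 1) / 2)) + 5 : ℕ) : ℝ) * ρn) ∧
            ‖((gaugeAct σ U₀ ⟨p.src, p.ν⟩ : SU2) : Matrix (Fin 2) (Fin 2) ℂ) - 1‖ ≤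
              max ρn ((((2 * (∑ i ∈ Finset.range (k + 1), ((F.P Kt).d * (((F.P Kt).L ^ i - 1) / 2) + 1)) + 1 +
                  (3 * ((F.P Kt).d * (((F.P Kt).L - 1) / 2)) + 5) * (F.P Kt).L ^ k : ℕ) : ℝ)) ^ 2 / 4 * (ν.εreg * (F.P Kt).eta 0 ^ 2) +
                ((3 * ((F.P Kt).d * (((F.P Kt).L - 1) / 2)) + 5 : ℕ) : ℝ) * θ k + ((3 * ((F.P Kt).d * (((F.P Kt).L - 1) / 2)) + 5 : ℕ) : ℝ) * ρn)) ∧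
        (∀ b ∈ inputs (Bj ν.M₁ Z k), b ∈ N →
          ‖((gaugeAct σ U₀ b : SU2) : Matrix (Fin 2) (Fin 2) ℂ) - 1‖ ≤
              max ρn ((((2 * (∑ i ∈ Finset.range (k + 1), ((F.P Kt).d * (((F.P Kt).L ^ i - 1) / 2) + 1)) + 1 +
                  (3 * ((F.P Kt).d * (((F.P Kt).L - 1) / 2)) + 5) * (F.P Kt).L ^ k : ℕ) : ℝ)) ^ 2 / 4 * (ν.εreg * (F.P Kt).eta 0 ^ 2) +
                ((3 * ((F.P Kt).d * (((F.P Kt).L - 1) / 2)) + 5 : ℕ) : ℝ) * θ k + ((3 * ((F.P Kt).d * (((F.P Kt).L - 1) / 2)) + 5 : ℕ) : ℝ) * ρn)) :=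
  exists_gaugeLetterLoc_atRecord_of_class ν Kt hk0 hk hM2 hdiv Z hεreg hN hRad hρn W 𝒞 hD hmin N hGN hN1 a θ hθ0 ha0 haN hθ ha hρn
    (datumLetter_of_shadows Kt hk (Bj ν.M₁ Z k) W hρn hD hGmem)

end Summit.QuantumFields.YangMills.BalabanUVNodes.N12DatumLetterOfShadows

end
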